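import Literature.NumberTheory.Transcendental.DirectionalJets
import Mathlib.Analysis.Complex.Liouville
import HarnessLib

/-!
# Smallness of mixed derivatives from smallness of values (polarization and Cauchy's inequality)

Topic `Literature/NumberTheory/Transcendental`. One PROVED lemma of complex analysis in several
variables used by the auxiliary function of [Waldschmidt1988, Prop. 6.1] for the linear group
(`LinearSubgroupTheoremAssembly.lean`, hypothesis `hAF`): the mixed derivatives
`D^kf(w)(v₀, …, v_{k−1})` of an analytic map `f : E → ℂ` — for `f(w) = P(exp_G w)` these are the
values of words of invariant derivations, `LinGroup.iteratedFDeriv_evalAt_mul_exp_apply`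
(`LinGroupDerivations.lean`), i.e. the algebraic numbers to which Liouville's inequality is
applied — are bounded by `2^k k^k ε` as soon as `|f| ≤ ε` on the unit circles through `w` in the
directions `(1/k) ∑_{i∈S} vᵢ`, `S ⊆ [k]`. Point: only directions of norm `≤ max ‖vᵢ‖` are used, so
the radius on which `f` must be small does not grow with the order `k` (in the application
`k < T ≈ Δ/log S` may exceed the radius `≈ S`). Ingredients: the polarization identity and the
symmetry of `D^kf` (`DirectionalJets.lean`), homogeneity of line jets, Cauchy's inequality
(`Complex.norm_iteratedDeriv_le_of_forall_mem_sphere_norm_le`).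

## References

* [Waldschmidt1988] M. Waldschmidt, *On the transcendence methods of Gel'fond and Schneider in
  several variables*, New Advances in Transcendence Theory (A. Baker ed.), CUP 1988, §6 (p. 389:
  "The estimates for the derivatives are provided by Lemma 7 of D. Bertrand …").
-/

noncomputable section

open scoped ContDiff
open Finset

namespace Literature.NumberTheory.Transcendental

variable {E : Type*} [NormedAddCommGroup E] [NormedSpace ℂ E]

/-- **Mixed derivatives of an analytic map are small where its values are small.** For a `C^ω`
map `f : E → ℂ`, a point `w` and directions `v₀, …, v_{k-1}`: if `|f| ≤ ε` on the unit circles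
`{w + t · (1/k) ∑_{i∈S} vᵢ ; |t| = 1}` for all `S ⊆ [k]`, then `‖D^kf(w)(v)‖ ≤ 2^k k^k ε`. Proof:
polarization (`MultilinearMap.polarization`) and the symmetry of `D^kf(w)`
(`ContDiffAt.iteratedFDeriv_comp_perm`) give `k! D^kf(w)(v) = ∑_S (−1)^{|Sᶜ|} D^kf(w)(x_S, …, x_S)`,
`x_S = ∑_{i∈S} vᵢ`; each diagonal value is a line jet (`iteratedDeriv_line_eq_iteratedFDeriv`),
homogeneous of degree `k` in the direction, hence `k^k` times the line jet along `x_S/k`, which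
Cauchy's inequality (`Complex.norm_iteratedDeriv_le_of_forall_mem_sphere_norm_le`) bounds by `k! ε`.
[folklore] -/
theorem norm_iteratedFDeriv_apply_le_of_small {f : E → ℂ} (hf : ContDiff ℂ ω f) (w : E) {k : ℕ}
    (v : Fin k → E) {ε : ℝ}
    (h : ∀ S : Finset (Fin k), ∀ t : ℂ, ‖t‖ = 1 →
      ‖f (w + t • (((k : ℂ))⁻¹ • ∑ i ∈ S, v i))‖ ≤ ε) :
    ‖iteratedFDeriv ℂ k f w v‖ ≤ 2 ^ k * (k : ℝ) ^ k * ε := by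
  classical
  set M := (iteratedFDeriv ℂ k f w).toMultilinearMap with hM
  have hMv : iteratedFDeriv ℂ k f w v = M v := rfl
  -- polarization and symmetry: `k! M v = ∑_S (-1)^{|Sᶜ|} M(x_S, …, x_S)`
  have hsymm : ∀ (σ : Equiv.Perm (Fin k)) (u : Fin k → E), M (fun j => u (σ j)) = M u :=
    fun σ u => hf.contDiffAt.iteratedFDeriv_comp_perm u σ
  have hpol := MultilinearMap.polarization M v
  have hR : ∑ σ : Equiv.Perm (Fin k), M (fun j => v (σ j)) = (k.factorial : ℂ) • M v := by
    rw [Finset.sum_congr rfl fun σ _ => hsymm σ v, Finset.sum_const, Finset.card_univ,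
      Fintype.card_perm, Fintype.card_fin, ← Nat.cast_smul_eq_nsmul ℂ]
  rw [hR] at hpol
  -- each diagonal value: `M(x_S^{×k}) = k^k · (line jet along x_S / k)`, bounded by `k^k k! ε`
  have hdiag : ∀ S : Finset (Fin k), ‖M (fun _ => ∑ i ∈ S, v i)‖ ≤ (k : ℝ) ^ k * (k.factorial * ε) := by
    intro S
    set y : E := ((k : ℂ))⁻¹ • ∑ i ∈ S, v i with hy
    by_cases hk : k = 0
    · subst hk
      -- `M () = f w`
      have hval : M (fun _ => ∑ i ∈ S, v i) = f w := by
        rw [hM, ContinuousMultilinearMap.coe_coe, iteratedFDeriv_zero_apply]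
      rw [hval]
      have hS : ∑ i ∈ S, v i = 0 := Finset.sum_eq_zero fun i _ => Fin.elim0 i
      have := h S 1 (by simp)
      rw [hS, smul_zero, smul_zero, add_zero] at this
      simpa using this
    · have hkpos : (0 : ℝ) < k := by exact_mod_cast Nat.pos_of_ne_zero hk
      have hxy : ∑ i ∈ S, v i = (k : ℂ) • y := by
        rw [hy, smul_smul, mul_inv_cancel₀ (by exact_mod_cast hk : (k : ℂ) ≠ 0), one_smul]
      have hscale : M (fun _ => ∑ i ∈ S, v i) = ((k : ℂ)) ^ k • M (fun _ => y) := by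
        rw [hxy]
        have := M.map_smul_univ (fun _ : Fin k => (k : ℂ)) (fun _ => y)
        rw [Finset.prod_const, Finset.card_univ, Fintype.card_fin] at this
        exact this
      have hline : M (fun _ => y) = iteratedDeriv k (fun t : ℂ => f (w + t • y)) 0 := by
        rw [hM, ContinuousMultilinearMap.coe_coe]
        exact (iteratedDeriv_line_eq_iteratedFDeriv hf w y (le_top : (k : WithTop ℕ∞) ≤ ω)).symm
      have hg : DiffContOnCl ℂ (fun t : ℂ => f (w + t • y)) (Metric.ball 0 1) := by
        refine Differentiable.diffContOnCl ?_
        exact (hf.differentiable (by simp)).comp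
          ((differentiable_const w).add (differentiable_id.smul_const y))
      have hcauchy := Complex.norm_iteratedDeriv_le_of_forall_mem_sphere_norm_le (c := 0) (R := 1)
        k zero_lt_one hg (C := ε) fun z hz => ?_
      · rw [one_pow, div_one] at hcauchy
        rw [hscale, norm_smul, norm_pow, Complex.norm_natCast, hline]
        exact mul_le_mul_of_nonneg_left hcauchy (by positivity)
      · have hz1 : ‖z‖ = 1 := by simpa using hz
        exact h S z hz1
  -- sum up
  have hsum : ‖(k.factorial : ℂ) • M v‖ ≤ 2 ^ k * ((k : ℝ) ^ k * (k.factorial * ε)) := by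
    rw [← hpol]
    calc ‖∑ S : Finset (Fin k), (-1 : ℂ) ^ (Sᶜ).card • M (fun _ => ∑ i ∈ S, v i)‖
        ≤ ∑ S : Finset (Fin k), ‖(-1 : ℂ) ^ (Sᶜ).card • M (fun _ => ∑ i ∈ S, v i)‖ := norm_sum_le _ _
      _ ≤ ∑ _S : Finset (Fin k), (k : ℝ) ^ k * (k.factorial * ε) := by
          refine Finset.sum_le_sum fun S _ => ?_
          rw [norm_smul, norm_pow, norm_neg, norm_one, one_pow, one_mul]
          exact hdiag S
      _ = 2 ^ k * ((k : ℝ) ^ k * (k.factorial * ε)) := by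
          rw [Finset.sum_const, Finset.card_univ, Fintype.card_finset, Fintype.card_fin,
            nsmul_eq_mul]
          push_cast
          ring
  have hfact : (0 : ℝ) < k.factorial := by exact_mod_cast k.factorial_pos
  rw [norm_smul, Complex.norm_natCast] at hsum
  rw [hMv]
  have : (k.factorial : ℝ) * ‖M v‖ ≤ (k.factorial : ℝ) * (2 ^ k * (k : ℝ) ^ k * ε) := by
    calc (k.factorial : ℝ) * ‖M v‖ ≤ 2 ^ k * ((k : ℝ) ^ k * (k.factorial * ε)) := hsum
      _ = (k.factorial : ℝ) * (2 ^ k * (k : ℝ) ^ k * ε) := by ring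
  exact le_of_mul_le_mul_left this hfact

end Literature.NumberTheory.Transcendental
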